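import Summits.RiemannHypothesis.RiemannHypothesis.Theorems.GroundBartaPolarPerronFrobeniusRobustSignDominance
import Summits.RiemannHypothesis.RiemannHypothesis.Theorems.WeilGroundStateGroundStatesConvergeToXiOverlapCriterion
import HarnessLib

/-!
# The OVERLAP form of crux `PolarPerronFrobenius` and the hierarchy of RH-free bridges
(route `RiemannHypothesis/GroundBarta`, crux stmt-RiemannHypothesis-18390; helper — RH-free)

Four hypotheses on a ground state `u` of the full windowed Weil form at a window `a`, each of which
— asked at cofinally many windows — implies the Riemann Hypothesis by an RH-free theorem in the tree
(`v = 𝟙_{(-a,a)}Re u`, `Φ = weilThetaPhi`):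
* SIGN (`GSP a`, crux #3 as filed): `Im u = 0`, `Re u ≥ 0` a.e. on `(-a,a)` — the rung's floor;
* R-FORM (`…RobustFloor`): `Im u = 0` a.e., `∫ v⁻Φ ≤ ∫ v⁺Φ/3`, `R_a(v⁻) ≤ e(a)∫ v⁺Φ/3` — implied by SIGN;
* MASS FORM (`…RobustSignDominance`): `Im u = 0` a.e., `∫ v⁻Φ ≤ ∫ v⁺Φ/3`, `∫ v⁺Φ ≥ exp(−e^{a})`;
* OVERLAP (this file, from the zero-side overlap–energy inequality of route `WeilGroundState`,
  `GroundStatesConvergeToXi.eventually_norm_overlap_phi_le_of_not_riemannHypothesis`):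
  `‖∫ u Φ‖ ≥ L·exp(−e^{a})` for a fixed `L > 0`.
Proved here: `riemannHypothesis_of_cofinal_thetaOverlap` (OVERLAP cofinally ⇒ RH; the threshold
`exp(−e^{a})` beats the double-exponential `e^{3a/2 − (π/4)e^{2(a−1)}}` of the overlap–energy
inequality), its even-sector-funnel form `riemannHypothesis_of_thetaOverlapPolarPerronFrobenius`, and
`thetaOverlap_of_signDominant` (MASS FORM ⇒ OVERLAP with `L = 2/3`, since
`Re ∫ uΦ = ∫ v⁺Φ − ∫ v⁻Φ ≥ (2/3)∫ v⁺Φ`).  So, as sufficient conditions for RH at cofinal windows,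
SIGN ⇒ R-FORM and MASS ⇒ OVERLAP, the weakest menu items being R-FORM (allows tiny `∫v⁺Φ`) and
OVERLAP (allows sign changes of any size as long as the theta-overlap survives).  RH-free; no
definitions.  References: Bombieri 2000 §4; CCM25 §7; Yoshida 1992.
-/

set_option linter.dupNamespace false

noncomputable section

open Set MeasureTheory Filter Complex
open scoped Real Topology ComplexConjugate

namespace Summit.RiemannHypothesis.RiemannHypothesis.Theorems.GroundBartaFloor

open Literature.NumberTheory.LFunctions
open Summit.RiemannHypothesis.RiemannHypothesis.Theorems.GroundStatesConvergeToXi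

/-! ## The threshold `exp(−e^a)` beats the overlap–energy constant -/

/-- For every `K` there is `a₀` with `K e^{3a/2} exp(−(π/4)e^{2(a−1)}) < L exp(−e^{a})` for all
`a ≥ a₀`, whenever `L > 0`. [folklore] -/
theorem ovl_threshold_eventually (K : ℝ) {L : ℝ} (hL : 0 < L) :
    ∃ a₀ : ℝ, ∀ a : ℝ, a₀ ≤ a →
      K * (Real.exp (-(π / 4 * Real.exp (2 * (a - 1)))) * Real.exp (3 / 2 * a)) <
        L * Real.exp (-Real.exp a) := by
  set c : ℝ := π / 4 * Real.exp (-2) with hc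
  have hc0 : 0 < c := by positivity
  have hc1 : c ≤ 1 := by
    have h1 : π / 4 ≤ 1 := by linarith [Real.pi_le_four]
    have h2 : Real.exp (-2 : ℝ) ≤ 1 := Real.exp_le_one_iff.2 (by norm_num)
    calc c = π / 4 * Real.exp (-2) := hc
      _ ≤ 1 * 1 := mul_le_mul h1 h2 (Real.exp_pos _).le zero_le_one
      _ = 1 := one_mul 1
  set ℓ : ℝ := |Real.log (|K| / L + 1)| with hℓ
  have hℓ0 : 0 ≤ ℓ := abs_nonneg _
  set B : ℝ := (5 + ℓ) / c with hB
  have hB0 : 0 < B := by positivity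
  have hB1 : 1 ≤ B := by rw [hB, le_div_iff₀ hc0]; nlinarith
  refine ⟨Real.log B + 1, fun a ha => ?_⟩
  have hlogB : 0 ≤ Real.log B := Real.log_nonneg hB1
  have ha0 : 0 ≤ a := by linarith
  have hx : B ≤ Real.exp a := by
    have h1 : Real.exp (Real.log B) ≤ Real.exp a := Real.exp_le_exp.2 (by linarith)
    rwa [Real.exp_log hB0] at h1
  have hxpos := Real.exp_pos a
  have hx1 : (1 : ℝ) ≤ Real.exp a := Real.one_le_exp ha0
  have hax : a ≤ Real.exp a := by linarith [Real.add_one_le_exp a]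
  have e1 : Real.exp (2 * (a - 1)) = Real.exp (-2) * (Real.exp a * Real.exp a) := by
    rw [← Real.exp_add, ← Real.exp_add]; congr 1; ring
  have hsq : π / 4 * Real.exp (2 * (a - 1)) = c * (Real.exp a * Real.exp a) := by
    rw [hc, e1]; ring
  have hcB : c * B = 5 + ℓ := by rw [hB]; field_simp
  have h1 : (5 + ℓ) * Real.exp a ≤ c * (Real.exp a * Real.exp a) := by
    have h := mul_le_mul_of_nonneg_left (mul_le_mul_of_nonneg_right hx hxpos.le) hc0.le
    have e : c * (B * Real.exp a) = (5 + ℓ) * Real.exp a := by rw [← hcB]; ring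
    linarith [h, e]
  have hkey : ℓ + 3 / 2 * a + Real.exp a ≤ c * (Real.exp a * Real.exp a) := by
    have h4 : ℓ * 1 ≤ ℓ * Real.exp a := mul_le_mul_of_nonneg_left hx1 hℓ0
    linarith
  -- compare exponentials
  have hKL : |K| < L * (|K| / L + 1) := by
    rw [mul_add, mul_div_cancel₀ _ hL.ne', mul_one]; linarith
  have hlogKL : Real.log (|K| / L + 1) ≤ ℓ := le_abs_self _
  have hpos1 : 0 < |K| / L + 1 := by positivity
  calc K * (Real.exp (-(π / 4 * Real.exp (2 * (a - 1)))) * Real.exp (3 / 2 * a))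
      ≤ |K| * (Real.exp (-(π / 4 * Real.exp (2 * (a - 1)))) * Real.exp (3 / 2 * a)) :=
        mul_le_mul_of_nonneg_right (le_abs_self K) (by positivity)
    _ < L * (|K| / L + 1) * (Real.exp (-(π / 4 * Real.exp (2 * (a - 1)))) * Real.exp (3 / 2 * a)) :=
        mul_lt_mul_of_pos_right hKL (by positivity)
    _ = L * Real.exp (Real.log (|K| / L + 1) + (-(π / 4 * Real.exp (2 * (a - 1))) + 3 / 2 * a)) := by
        rw [Real.exp_add, Real.exp_add, Real.exp_log hpos1]; ring
    _ ≤ L * Real.exp (-Real.exp a) := by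
        refine mul_le_mul_of_nonneg_left (Real.exp_le_exp.2 ?_) hL.le
        rw [hsq]; linarith

/-! ## OVERLAP cofinally ⇒ RH -/

/-- **RH from a non-negligible theta-overlap, cofinally.**  If for some `L > 0` there are, beyond
every height, a window `a` and a ground state `u` at `a` with `‖∫ u·Φ‖ ≥ L exp(−e^{a})`
(`Φ = weilThetaPhi`, Riemann's kernel), then the Riemann Hypothesis holds — by the overlap–energy
dichotomy of route WeilGroundState (under `¬RH` every ground state at every large window has
`‖∫ uΦ‖ ≤ K e^{3a/2 − (π/4)e^{2(a−1)}}`). [folklore] -/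
theorem riemannHypothesis_of_cofinal_thetaOverlap {L : ℝ} (hL : 0 < L)
    (h : ∀ A : ℝ, ∃ a : ℝ, A ≤ a ∧ ∃ u : ℝ → ℂ, IsWeilGroundState a u ∧
      L * Real.exp (-Real.exp a) ≤ ‖∫ t, u t * ((weilThetaPhi t : ℝ) : ℂ)‖) :
    RiemannHypothesis := by
  by_contra hRH
  obtain ⟨K, -, hK⟩ := eventually_norm_overlap_phi_le_of_not_riemannHypothesis hRH
  obtain ⟨A₁, hA₁⟩ := Filter.eventually_atTop.1 hK
  obtain ⟨a₀, ha₀⟩ := ovl_threshold_eventually K hL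
  obtain ⟨a, ha, u, hu, hov⟩ := h (max A₁ a₀)
  have h1 := hA₁ a ((le_max_left _ _).trans ha) u hu
  have h2 := ha₀ a ((le_max_right _ _).trans ha)
  have e : ∫ t, u t * ((weilThetaPhi t : ℝ) : ℂ) =
      ∫ t, u t * conj ((2 : ℂ) * LagariasMontague.Psic (2 * t)) := by
    refine integral_congr_ae (ae_of_all _ fun t => ?_)
    dsimp only
    rw [conj_phi, leakEnv_ofReal_weilThetaPhi]
  rw [e] at hov
  linarith

/-- **The overlap form of the crux closes the route**: if beyond every height there is a window at
which, whenever the even sector carries the bottom, some ground state has theta-overlap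
`‖∫ uΦ‖ ≥ L exp(−e^{a})` (`L > 0` fixed), then `EvenWinsBeyondArch` implies RH. [folklore] -/
theorem riemannHypothesis_of_thetaOverlapPolarPerronFrobenius {L : ℝ} (hL : 0 < L)
    (hOv : ∀ A : ℝ, ∃ a : ℝ, A ≤ a ∧
      ((∀ o : ℝ → ℂ, IsWeilTest o → tsupport o ⊆ Icc (-a) a → (∀ t, o (-t) = -o t) →
          ∫ t, ‖o t‖ ^ 2 = (1 : ℝ) → ∀ δ : ℝ, 0 < δ → ∃ w : ℝ → ℂ, IsWeilTest w ∧
            tsupport w ⊆ Icc (-a) a ∧ (∀ t, w (-t) = w t) ∧ ∫ t, ‖w t‖ ^ 2 = (1 : ℝ) ∧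
            (weilQuadratic w).re ≤ (weilQuadratic o).re + δ) →
        ∃ u : ℝ → ℂ, IsWeilGroundState a u ∧
          L * Real.exp (-Real.exp a) ≤ ‖∫ t, u t * ((weilThetaPhi t : ℝ) : ℂ)‖))
    (hEven : Summit.RiemannHypothesis.RiemannHypothesis.Theses.GroundBarta.EvenWinsBeyondArch) :
    RiemannHypothesis := by
  have hEW : ∀ a : ℝ, Real.log 2 / 2 < a → ∀ o : ℝ → ℂ, IsWeilTest o →
      tsupport o ⊆ Icc (-a) a → (∀ t, o (-t) = -o t) → ∫ t, ‖o t‖ ^ 2 = (1 : ℝ) → ∀ δ : ℝ, 0 < δ →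
      ∃ w : ℝ → ℂ, IsWeilTest w ∧ tsupport w ⊆ Icc (-a) a ∧ (∀ t, w (-t) = w t) ∧
        ∫ t, ‖w t‖ ^ 2 = (1 : ℝ) ∧ (weilQuadratic w).re ≤ (weilQuadratic o).re + δ := hEven
  refine riemannHypothesis_of_cofinal_thetaOverlap hL fun A => ?_
  obtain ⟨a, ha, hgood⟩ := hOv (max A 1)
  have haA : A ≤ a := le_trans (le_max_left _ _) ha
  have ha1 : (1 : ℝ) ≤ a := le_trans (le_max_right _ _) ha
  have hlog : Real.log 2 / 2 < a := by
    have h2 : Real.log 2 < 0.6931471808 := Real.log_two_lt_d9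
    linarith
  exact ⟨a, haA, hgood (hEW a hlog)⟩

/-! ## MASS FORM ⇒ OVERLAP -/

/-- **Φ-weighted sign dominance gives theta-overlap.**  For a ground state `u` at `a > 0` with
`Im u = 0` a.e. on `(-a,a)`, `∫ v⁻Φ ≤ (1/3)∫ v⁺Φ` and `∫ v⁺Φ ≥ exp(−e^{a})`:
`‖∫ uΦ‖ ≥ (2/3) exp(−e^{a})`, because `Re ∫ uΦ = ∫ v⁺Φ − ∫ v⁻Φ`. [folklore] -/
theorem thetaOverlap_of_signDominant {a : ℝ} {u : ℝ → ℂ} (hu : IsWeilGroundState a u)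
    (hreal : ∀ᵐ t : ℝ, t ∈ Ioo (-a) a → (u t).im = 0)
    (hneg : (∫ t, max (-(Ioo (-a) a).indicator (fun t => (u t).re) t) 0 * weilThetaPhi t) ≤
      (1 / 3) * (∫ t, max ((Ioo (-a) a).indicator (fun t => (u t).re) t) 0 * weilThetaPhi t))
    (hpos : Real.exp (-Real.exp a) ≤
      (∫ t, max ((Ioo (-a) a).indicator (fun t => (u t).re) t) 0 * weilThetaPhi t)) :
    2 / 3 * Real.exp (-Real.exp a) ≤ ‖∫ t, u t * ((weilThetaPhi t : ℝ) : ℂ)‖ := by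
  obtain ⟨hu2, -⟩ := id hu
  set v : ℝ → ℝ := (Ioo (-a) a).indicator fun t => (u t).re with hv
  set vp : ℝ → ℝ := fun t => max (v t) 0 with hvp
  set vm : ℝ → ℝ := fun t => max (-v t) 0 with hvm
  set P : ℝ := ∫ t, vp t * weilThetaPhi t with hP
  set N : ℝ := ∫ t, vm t * weilThetaPhi t with hN
  change N ≤ 1 / 3 * P at hneg
  change Real.exp (-Real.exp a) ≤ P at hpos
  -- `u = v` a.e. (real on the window, zero off it)
  have hnull : (volume : Measure ℝ) {-a, a} = 0 := (Set.toFinite _).measure_zero volume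
  have hae2 := measure_eq_zero_iff_ae_notMem.1 hnull
  have hae : u =ᵐ[volume] fun t => ((v t : ℝ) : ℂ) := by
    filter_upwards [hreal, hu.ae_eq_zero_of_notMem, hae2] with t h1 h2 h3
    by_cases ht : t ∈ Ioo (-a) a
    · simp only [hv, indicator_of_mem ht]
      exact Complex.ext (by simp) (by simp [h1 ht])
    · have hm : t ∉ Icc (-a) a := by
        intro hm
        simp only [mem_insert_iff, mem_singleton_iff, not_or] at h3
        exact ht ⟨lt_of_le_of_ne hm.1 (fun h => h3.1 h.symm), lt_of_le_of_ne hm.2 h3.2⟩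
      simp only [hv, indicator_of_notMem ht, h2 hm, Complex.ofReal_zero]
  -- integrability of the moments
  have hv_le : ∀ t, |v t| ≤ ‖u t‖ := fun t => by
    by_cases ht : t ∈ Ioo (-a) a
    · simp only [hv, indicator_of_mem ht]; exact Complex.abs_re_le_norm _
    · simp only [hv, indicator_of_notMem ht, abs_zero]; exact norm_nonneg _
  have hv_meas : AEStronglyMeasurable v volume :=
    (Complex.continuous_re.comp_aestronglyMeasurable hu2.1).indicator measurableSet_Ioo
  have hmom : ∀ {w : ℝ → ℝ}, AEStronglyMeasurable w volume → (∀ t, |w t| ≤ ‖u t‖) →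
      Integrable fun t => w t * weilThetaPhi t := by
    intro w hw hwle
    refine Integrable.mono' (hu.integrable.norm.mul_const (weilThetaPhi 0))
      (hw.mul continuous_weilThetaPhi.aestronglyMeasurable) (Eventually.of_forall fun t => ?_)
    rw [Real.norm_eq_abs, abs_mul, abs_of_pos (weilThetaPhi_pos t)]
    exact mul_le_mul (hwle t) (gbf_weilThetaPhi_le_zero_val t) (weilThetaPhi_pos t).le
      (norm_nonneg _)
  have hvp_le : ∀ t, |vp t| ≤ ‖u t‖ := fun t => by
    rw [abs_of_nonneg (le_max_right _ _)]
    exact (max_le (le_abs_self _) (abs_nonneg _)).trans (hv_le t)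
  have hvm_le : ∀ t, |vm t| ≤ ‖u t‖ := fun t => by
    rw [abs_of_nonneg (le_max_right _ _)]
    exact (max_le (neg_le_abs _) (abs_nonneg _)).trans (hv_le t)
  have hvp_meas : AEStronglyMeasurable vp volume := hv_meas.sup aestronglyMeasurable_const
  have hvm_meas : AEStronglyMeasurable vm volume := hv_meas.neg.sup aestronglyMeasurable_const
  have hvpΦ := hmom hvp_meas hvp_le
  have hvmΦ := hmom hvm_meas hvm_le
  -- `∫ uΦ = P − N` (a real number)
  have hI : ∫ t, u t * ((weilThetaPhi t : ℝ) : ℂ) = (((P - N : ℝ)) : ℂ) := by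
    have h1 : ∫ t, u t * ((weilThetaPhi t : ℝ) : ℂ) = ∫ t, ((v t * weilThetaPhi t : ℝ) : ℂ) := by
      refine integral_congr_ae (hae.mono fun t ht => ?_)
      simp only [ht]; push_cast; ring
    rw [h1, integral_complex_ofReal, hP, hN, ← integral_sub hvpΦ hvmΦ]
    congr 1
    refine integral_congr_ae (ae_of_all _ fun t => ?_)
    simp only [hvp, hvm]
    rw [← sub_mul, max_zero_sub_max_neg_zero_eq_self]
  rw [hI, Complex.norm_real, Real.norm_eq_abs]
  have : 2 / 3 * Real.exp (-Real.exp a) ≤ P - N := by linarith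
  exact this.trans (le_abs_self _)

/-! ## The dichotomy under `¬RH` -/

/-- **Under `¬RH`, every ground state at every large window is Φ-sign-balanced or Φ-negligible**:
there is a height `A` beyond which NO ground state `u` with `Im u = 0` a.e. on the window has both
`∫ v⁻Φ ≤ (1/3)∫ v⁺Φ` and `∫ v⁺Φ ≥ exp(−e^{a})` (contrapositive of
`riemannHypothesis_of_cofinal_signDominantGroundState`). [folklore] -/
theorem eventually_not_signDominant_of_not_riemannHypothesis (hRH : ¬ RiemannHypothesis) :
    ∃ A : ℝ, ∀ a : ℝ, A ≤ a → ∀ u : ℝ → ℂ, IsWeilGroundState a u →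
      (∀ᵐ t : ℝ, t ∈ Ioo (-a) a → (u t).im = 0) →
      (∫ t, max (-(Ioo (-a) a).indicator (fun t => (u t).re) t) 0 * weilThetaPhi t) ≤
        (1 / 3) * (∫ t, max ((Ioo (-a) a).indicator (fun t => (u t).re) t) 0 * weilThetaPhi t) →
      (∫ t, max ((Ioo (-a) a).indicator (fun t => (u t).re) t) 0 * weilThetaPhi t) <
        Real.exp (-Real.exp a) := by
  by_contra h
  push Not at h
  exact hRH (riemannHypothesis_of_cofinal_signDominantGroundState fun A => by
    obtain ⟨a, ha, u, hu, hreal, hneg, hpos⟩ := h A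
    exact ⟨a, ha, u, hu, hreal, hneg, hpos⟩)

/-- **Under `¬RH`, the theta-overlap of every ground state decays faster than `exp(−e^{a})`**:
for every `L > 0`, beyond some height every ground state has `‖∫ uΦ‖ < L exp(−e^{a})`
(contrapositive of `riemannHypothesis_of_cofinal_thetaOverlap`). [folklore] -/
theorem eventually_thetaOverlap_lt_of_not_riemannHypothesis (hRH : ¬ RiemannHypothesis) {L : ℝ}
    (hL : 0 < L) :
    ∃ A : ℝ, ∀ a : ℝ, A ≤ a → ∀ u : ℝ → ℂ, IsWeilGroundState a u →
      ‖∫ t, u t * ((weilThetaPhi t : ℝ) : ℂ)‖ < L * Real.exp (-Real.exp a) := by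
  by_contra h
  push Not at h
  exact hRH (riemannHypothesis_of_cofinal_thetaOverlap hL fun A => by
    obtain ⟨a, ha, u, hu, hov⟩ := h A
    exact ⟨a, ha, u, hu, hov⟩)

end Summit.RiemannHypothesis.RiemannHypothesis.Theorems.GroundBartaFloor

end
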